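/-
Origin: expansion seat `planner-pub-hodgecm-mc-glue-1-g11-0`, handover #SG30 2026-08-20T16:55:47Z md5 761d7e371d1d (REPLACE; pre md5 ae1f91140085 → new md5 761d7e371d1d; 118 l.; (μ4) scope-guard rewrite of the RUN-55 installed file; family glue-1; compiled ok 0 proof-hole) (`HOME/mc/pub-hodgecm-mc-glue-1-g11/stage56/HodgeCM/Model/E2InstanceOGR21AEPISTR2DJWHHTC.lean`, md5 761d7e371d1d, 118 lines);
landed by the second packager p2 gen 10 (p2-g10) in gate run 56 REPLACES the earlier landed copy of `HodgeCM/Model/E2InstanceOGR21AEPISTR2DJWHHTC.lean` (seat copy carried the packager Origin header of an earlier run (stripped)).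
-/
/-
Origin: CONSTRUCTION seat `planner-pub-hodgecm-mc-glue-1-g11-0` (unit pub-hodgecm-mc-glue-1-g11, gen 11 of mc-glue-1, node E ASSEMBLER), 2026-08-20,
generated from glue-1's staged #398J2HHT `E2InstanceOGR21AEPISTR2DJWHHT.lean` by `tools/gen_child.py spec/str2djwhhtc.json` + `tools/gen_c2.py`;
CROSS-KIT ROWDEP: binder-1's `Binders/Real34CensusSigmaP2` + `Binders/Real34PinsROGT2` (+ their P2 chains) — install after them, drops with them.
KERNEL only: 1 theorem, 0 defs; intended closure {propext, Classical.choice, Quot.sound}.  Target in PKG: HodgeCM/Model/E2InstanceOGR21AEPISTR2DJWHHTC.lean (NEW additive leaf).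
-/
import Summits.HodgeConjecture.HodgeCM.Model.E2InstanceOGR21AEPISTR2DJWHHT
import Summits.HodgeConjecture.HodgeCM.Model.Binders.Real34CensusSigmaP2
import Summits.HodgeConjecture.HodgeCM.Model.ArchKTypeOfSigmaR1Family
import Summits.HodgeConjecture.HodgeCM.Model.ArchPinWeightDischarge34
import Summits.HodgeConjecture.HodgeCM.Model.ArchKTypeOfLineSupplyPin

noncomputable section

open scoped TensorProduct InnerProductSpace Matrix

open Literature.NumberTheory.Automorphic Literature.NumberTheory.Weil1964
open Literature.NumberTheory.GelbartRogawski1991.UnitaryDualPair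
open HodgeCM.Adelic HodgeCM.PerL34
open scoped Classical
open Literature.Geometry.ComplexHyperbolic.BallModel (U21 x₀ stabilizerEquivK21)
open Literature.NumberTheory.Automorphic.U21 (K21 matA sclD)

/-!
# E2InstanceOGR21AEPISTR2DJWHHTC — ROW 17 OF THE R2 LEAF CLOSED: the census-T record `CT` of #398J2HHT STRUCK through binder-1's P2 socket, EVERY residual discharged at E's pin

`perL_picardCM_r21AEOGISTR2DJWHHTC` = glue-1's #398J2HHT `perL_picardCM_r21AEOGISTR2DJWHHT` (11 groups `hA hGR hGR₀ hGR₁ hGR₂ hGR₃ μ hR hΘ gen12 CT`) with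
`CT := fun V c hc hK hemb => Gen12PinsP2.Real34CensusSideT.ofCensus34 … hW hs jD hκ hμ₃₄ hpos₂ hpos₃ hLF₂ hLF₃ hsupply` (binder-1 `Binders/Real34CensusSigmaP2`:
the row-17 socket at the (B1′) orientation `σ := sigma34 c.D`, `homg₃₄` ∕ `hdense` ∕ `harch` discharged inside, `Z₂ Z₃` the vacuum line families) where, at the
OG guard `G′ := ⟨hemb, hc⟩ : SInstance.GOG V c` of the good sextic canonical context: `hW := AdelicThetaCore.isAnisotropic_gramW_of_goodCtx … hc` and
`hs := SInstance.hG_GOG V c G′` (exactly as in the installed S-lineage socket leaf #399C `E2InstanceOGR21AEPISCWRTC`, RUN 45); `jD := fun _ _ => 0` (the census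
place datum is free, as in #398HH ∕ #398J2HH rows 18∕19); `hκ := SInstance.hκ_R1_of_GOG_eta hGR hGR₀ hGR₁ (χWR … μ♯♯) V c G′ hs` (carch-1 #CA39
`ArchKTypeOfSigmaR1Family`: the (V-val) letter-character identity HOLDS at the R1 character `χVR` for ANY `χW`); `hμ₃₄ := fun t => ArchSideTerm.hμ₃₄_GOG hGR χVR
hGR₀ hGR₁ hGR₂ hGR₃ μ V c G′ hs _ t` (theta-3 (K14) `ArchPinWeightDischarge34`, verbatim binder-2's use in #N5 `KappaJoinMu34` :144); `hpos₂ ∕ hpos₃ :=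
(SInstance.hpos_GOG V c G′).2.2.1 ∕ .2.2.2` (`ThetaAdelicSideReadOff`); `hLF₂ ∕ hLF₃ := SInstance.hLF_ROGT'CJ … V c 2 ∕ 3` (sinst-1 #1229 `ThetaAdelicSideR2` :152,
hypothesis-free at the R2 pin); `hsupply := SInstance.hsupply_two_three_ROGT'CJ hHD hI h₁ h₃′ hGR… μ V c G′ hV` (carch-1 #CA59 `ArchKTypeOfLineSupplyPin` :139, the
(W-0-SUPPLY) for lines 2, 3 at the R2 pin with no PROVE input; junction pre-tested by carch-1, STATUS l.13675).
Binder groups 11 → 10: `hA hGR hGR₀ hGR₁ hGR₂ hGR₃ μ hR hΘ gen12` — `CT` CONSUMED, NOTHING new: ROW 17 (`real34`) of E is, at the R2 pin, a THEOREM of the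
constructed pin data (rows 17, 18, 19 all closed in the R2 lineage; rows 4∕5∕12∕13∕14∕15 pinned ∕ discharged before); every other text is #398J2HHT's
byte for byte; conclusion `Universe.PerL` unchanged; proof = ONE application.
ADDITIVE LEAF of the closing chain BESIDE E — E's term of record `perL_picardCM_r21AEOGI` «14 · 0» untouched; no new definition, record or cite enters;
nothing of PerL ∕ QW8 is claimed.
-/

namespace HodgeCM

namespace Model

open HodgeCM.Model.ArchSideTerm
open HodgeCM.Universe (AdelicThetaCore AdelicThetaCore₀ SideData ThetaModel ModelAxiomsPerL)
open Literature.AlgebraicGeometry.HodgeTheory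
open Literature.AlgebraicGeometry.ComplexMultiplication (Shimura1998_Thm3_isogenousPower Shimura1998_Thm2_Cor)
open Literature.NumberTheory.Automorphic.PicardCM
open Literature.NumberTheory.Transcendental (Arapura2012_Cor_15_4_6)
open HodgeCM.CMTypeOps (inflate)
open HodgeCM.Model.SupplyResidual (ClassSupplyPackN)
open HodgeCM.Model.ThetaSpace

variable (hHD : exists_isReal_hodgeModel) (hI : hodgePQ_independent_of_hodgeModel)
  (h₁ : BallQuotientUniformised)  (h₃ : CMAbelianVarietyEigenbasisRealised)

/-- **ROW 17 OF THE R2 LEAF CLOSED** (`CT := fun V c hc hK hemb => Gen12PinsP2.Real34CensusSideT.ofCensus34 … hW hs 0 hκ hμ₃₄ hpos₂ hpos₃ hLF₂ hLF₃ hsupply`,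
all PKG dischargers at the OG guard): 10 binder groups `hA hGR hGR₀ hGR₁ hGR₂ hGR₃ μ hR hΘ gen12`; one application of `perL_picardCM_r21AEOGISTR2DJWHHT`. -/
theorem perL_picardCM_r21AEOGISTR2DJWHHTC (hA : Arapura2012_Cor_15_4_6)
    (hGR : ∀ {L : CMField} {ι₁ : L →+* ℂ} (V : HermSpace3 L ι₁) (c : SeesawCtx L),
      (cmSplittingDatum (L : Type) finProdFinEquiv (frameD V) (frameD_real V) (frameD_ne V) (dW c.D) (dW_real c.D)
        (dW_ne c.D)).CompatibleSplitting)
    (hGR₀ : ∀ {L : CMField} {ι₁ : L →+* ℂ} (V : HermSpace3 L ι₁) (c : SeesawCtx L),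
      (cmSplittingDatum (L : Type) (e₁) (frameD V) (frameD_real V) (frameD_ne V) (lineVec (L : Type) (dW c.D 0))
        (fun _ => dW_real c.D 0) (fun _ => dW_ne c.D 0)).CompatibleSplitting)
    (hGR₁ : ∀ {L : CMField} {ι₁ : L →+* ℂ} (V : HermSpace3 L ι₁) (c : SeesawCtx L),
      (cmSplittingDatum (L : Type) (e₁) (frameD V) (frameD_real V) (frameD_ne V) (lineVec (L : Type) (dW c.D 1))
        (fun _ => dW_real c.D 1) (fun _ => dW_ne c.D 1)).CompatibleSplitting)
    (hGR₂ : ∀ {L : CMField} {ι₁ : L →+* ℂ} (V : HermSpace3 L ι₁) (c : SeesawCtx L),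
      (cmSplittingDatum (L : Type) (e₁) (frameD V) (frameD_real V) (frameD_ne V) (lineVec (L : Type) (dW' c.D 0))
        (fun _ => dW'_real c.D 0) (fun _ => dW'_ne c.D 0)).CompatibleSplitting)
    (hGR₃ : ∀ {L : CMField} {ι₁ : L →+* ℂ} (V : HermSpace3 L ι₁) (c : SeesawCtx L),
      (cmSplittingDatum (L : Type) (e₁) (frameD V) (frameD_real V) (frameD_ne V) (lineVec (L : Type) (dW' c.D 1))
        (fun _ => dW'_real c.D 1) (fun _ => dW'_ne c.D 1)).CompatibleSplitting)
    (μ : ∀ {L : CMField}, SeesawCtx L → Fin 4 → NumberField.InfinitePlace L → ℤ)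
    (hR : DeligneMilne1982_Thm_6_20_full)
    (hΘ : ∀ {L : CMField} {ι₁ : L →+* ℂ} (V : HermSpace3 L ι₁) (c : SeesawCtx L),
      (thetaModelOf hHD hI h₁ (cmAbelianVarietyRealised_of_eigenbasis hHD hI h₃) (orientBitι L ι₁) (embOf hHD hI h₁ (cmAbelianVarietyRealised_of_eigenbasis hHD hI h₃)) (coverOf hHD hI h₁ (cmAbelianVarietyRealised_of_eigenbasis hHD hI h₃) hA) (wmOfInput (HypCensus.Wcm hGR (EtaChi.η (@SInstance.χVR @hGR @hGR₀ @hGR₁) (@SInstance.χWR @hGR @hGR₀ @hGR₁ (ArchSideTerm.muSharp₂₃ @μ))) (EtaChi.hη (@SInstance.χVR @hGR @hGR₀ @hGR₁) (@SInstance.χWR @hGR @hGR₀ @hGR₁ (ArchSideTerm.muSharp₂₃ @μ))) (EtaChi.hηc (@SInstance.χVR @hGR @hGR₀ @hGR₁) (@SInstance.χWR @hGR @hGR₀ @hGR₁ (ArchSideTerm.muSharp₂₃ @μ))))) (thetaOf _ (thetaClassInputOf _ (fun V c => thetaSpaceInputOf hHD hI h₁ (cmAbelianVarietyRealised_of_eigenbasis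 hHD hI h₃) (SInstance.SROGT'C @hGR @hGR₀ @hGR₁ @hGR₂ @hGR₃ (ArchSideTerm.muSharp₂₃ @μ) (ArchSideTerm.hΔ₁_GOG_muSharp₂₃ @hGR @hGR₀ @hGR₁ @hGR₂ @hGR₃ @μ) (ArchSideTerm.hΔ₂_GOG_muSharp₂₃ @hGR @hGR₀ @hGR₁ @hGR₂ @hGR₃ @μ (ArchSideTerm.hSV_holds @hGR)) (ArchSideTerm.hΔ₃_GOG_muSharp₂₃ @hGR @hGR₀ @hGR₁ @hGR₂ @hGR₃ @μ (ArchSideTerm.hSV_holds @hGR))) V c))) (d12Of (ArchSideTerm.muSharp₂₃ @μ)) (d34Of (ArchSideTerm.muSharp₂₃ @μ))).GoodCtx ι₁ c → Module.finrank ℚ c.K = 6 ∧ IsNormalClosure ℚ c.K L ∧ (Module.finrank ℚ L = 24 ∨ Module.finrank ℚ L = 48) →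
      (NumberField.InfinitePlace.mk ι₁).embedding = ι₁ →
      ∀ i : Fin 4, ∃ Γ₀ : Level V, ∀ Γ ≤ Γ₀,
        ∃ D : CommonReflexInput c.K (c.Ψ i) c.σ,
          (thetaModelOf hHD hI h₁ (cmAbelianVarietyRealised_of_eigenbasis hHD hI h₃) (orientBitι L ι₁) (embOf hHD hI h₁ (cmAbelianVarietyRealised_of_eigenbasis hHD hI h₃)) (coverOf hHD hI h₁ (cmAbelianVarietyRealised_of_eigenbasis hHD hI h₃) hA) (wmOfInput (HypCensus.Wcm hGR (EtaChi.η (@SInstance.χVR @hGR @hGR₀ @hGR₁) (@SInstance.χWR @hGR @hGR₀ @hGR₁ (ArchSideTerm.muSharp₂₃ @μ))) (EtaChi.hη (@SInstance.χVR @hGR @hGR₀ @hGR₁) (@SInstance.χWR @hGR @hGR₀ @hGR₁ (ArchSideTerm.muSharp₂₃ @μ))) (EtaChi.hηc (@SInstance.χVR @hGR @hGR₀ @hGR₁) (@SInstance.χWR @hGR @hGR₀ @hGR₁ (ArchSideTerm.muSharp₂₃ @μ))))) (thetaOf _ (thetaClassInputOf _ (fun V c => thetaSpaceInputOf hHD hI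 h₁ (cmAbelianVarietyRealised_of_eigenbasis hHD hI h₃) (SInstance.SROGT'C @hGR @hGR₀ @hGR₁ @hGR₂ @hGR₃ (ArchSideTerm.muSharp₂₃ @μ) (ArchSideTerm.hΔ₁_GOG_muSharp₂₃ @hGR @hGR₀ @hGR₁ @hGR₂ @hGR₃ @μ) (ArchSideTerm.hΔ₂_GOG_muSharp₂₃ @hGR @hGR₀ @hGR₁ @hGR₂ @hGR₃ @μ (ArchSideTerm.hSV_holds @hGR)) (ArchSideTerm.hΔ₃_GOG_muSharp₂₃ @hGR @hGR₀ @hGR₁ @hGR₂ @hGR₃ @μ (ArchSideTerm.hSV_holds @hGR))) V c))) (d12Of (ArchSideTerm.muSharp₂₃ @μ)) (d34Of (ArchSideTerm.muSharp₂₃ @μ))).Theta V c i Γ ⊆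
            Submodule.span ℂ (D.surfaceClasses hHD hI h₁ (cmAbelianVarietyRealised_of_eigenbasis hHD hI h₃) V Γ))
    (gen12 : ∀ {L : CMField} {ι₁ : L →+* ℂ} (V : HermSpace3 L ι₁) (c : SeesawCtx L),
      (thetaModelOf hHD hI h₁ (cmAbelianVarietyRealised_of_eigenbasis hHD hI h₃) (orientBitι L ι₁) (embOf hHD hI h₁ (cmAbelianVarietyRealised_of_eigenbasis hHD hI h₃)) (coverOf hHD hI h₁ (cmAbelianVarietyRealised_of_eigenbasis hHD hI h₃) hA) (wmOfInput (HypCensus.Wcm hGR (EtaChi.η (@SInstance.χVR @hGR @hGR₀ @hGR₁) (@SInstance.χWR @hGR @hGR₀ @hGR₁ (ArchSideTerm.muSharp₂₃ @μ))) (EtaChi.hη (@SInstance.χVR @hGR @hGR₀ @hGR₁) (@SInstance.χWR @hGR @hGR₀ @hGR₁ (ArchSideTerm.muSharp₂₃ @μ))) (EtaChi.hηc (@SInstance.χVR @hGR @hGR₀ @hGR₁) (@SInstance.χWR @hGR @hGR₀ @hGR₁ (ArchSideTerm.muSharp₂₃ @μ))))) (thetaOf _ (thetaClassInputOf _ (fun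 V c => thetaSpaceInputOf hHD hI h₁ (cmAbelianVarietyRealised_of_eigenbasis hHD hI h₃) (SInstance.SROGT'C @hGR @hGR₀ @hGR₁ @hGR₂ @hGR₃ (ArchSideTerm.muSharp₂₃ @μ) (ArchSideTerm.hΔ₁_GOG_muSharp₂₃ @hGR @hGR₀ @hGR₁ @hGR₂ @hGR₃ @μ) (ArchSideTerm.hΔ₂_GOG_muSharp₂₃ @hGR @hGR₀ @hGR₁ @hGR₂ @hGR₃ @μ (ArchSideTerm.hSV_holds @hGR)) (ArchSideTerm.hΔ₃_GOG_muSharp₂₃ @hGR @hGR₀ @hGR₁ @hGR₂ @hGR₃ @μ (ArchSideTerm.hSV_holds @hGR))) V c))) (d12Of (ArchSideTerm.muSharp₂₃ @μ)) (d34Of (ArchSideTerm.muSharp₂₃ @μ))).GoodCtx ι₁ c → Module.finrank ℚ c.K = 6 ∧ IsNormalClosure ℚ c.K L ∧ (Module.finrank ℚ L = 24 ∨ Module.finrank ℚ L = 48) →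
      (NumberField.InfinitePlace.mk ι₁).embedding = ι₁ →
      Nonempty ((thetaModelOf hHD hI h₁ (cmAbelianVarietyRealised_of_eigenbasis hHD hI h₃) (orientBitι L ι₁) (embOf hHD hI h₁ (cmAbelianVarietyRealised_of_eigenbasis hHD hI h₃)) (coverOf hHD hI h₁ (cmAbelianVarietyRealised_of_eigenbasis hHD hI h₃) hA) (wmOfInput (HypCensus.Wcm hGR (EtaChi.η (@SInstance.χVR @hGR @hGR₀ @hGR₁) (@SInstance.χWR @hGR @hGR₀ @hGR₁ (ArchSideTerm.muSharp₂₃ @μ))) (EtaChi.hη (@SInstance.χVR @hGR @hGR₀ @hGR₁) (@SInstance.χWR @hGR @hGR₀ @hGR₁ (ArchSideTerm.muSharp₂₃ @μ))) (EtaChi.hηc (@SInstance.χVR @hGR @hGR₀ @hGR₁) (@SInstance.χWR @hGR @hGR₀ @hGR₁ (ArchSideTerm.muSharp₂₃ @μ))))) (thetaOf _ (thetaClassInputOf _ (fun V c => thetaSpaceInputOf hHD hI h₁ (cmAbelianVarietyRealised_of_eigenbasis hHD hI h₃) (SInstance.SROGT'C @hGR @hGR₀ @hGR₁ @hGR₂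 @hGR₃ (ArchSideTerm.muSharp₂₃ @μ) (ArchSideTerm.hΔ₁_GOG_muSharp₂₃ @hGR @hGR₀ @hGR₁ @hGR₂ @hGR₃ @μ) (ArchSideTerm.hΔ₂_GOG_muSharp₂₃ @hGR @hGR₀ @hGR₁ @hGR₂ @hGR₃ @μ (ArchSideTerm.hSV_holds @hGR)) (ArchSideTerm.hΔ₃_GOG_muSharp₂₃ @hGR @hGR₀ @hGR₁ @hGR₂ @hGR₃ @μ (ArchSideTerm.hSV_holds @hGR))) V c))) (d12Of (ArchSideTerm.muSharp₂₃ @μ)) (d34Of (ArchSideTerm.muSharp₂₃ @μ))).Gen12FunBridge V c)) :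
     (picardCMUniverse hHD hI h₁ (cmAbelianVarietyRealised_of_eigenbasis hHD hI h₃)).PerL
:=
  perL_picardCM_r21AEOGISTR2DJWHHT hHD hI h₁ h₃ hA hGR hGR₀ hGR₁ hGR₂ hGR₃ μ hR hΘ gen12
    (fun {L} {ι₁} V c hc hK hemb =>
      Gen12PinsP2.Real34CensusSideT.ofCensus34 @SInstance.GOG @SInstance.hG_GOG @hGR (@EtaChi.η (@SInstance.χVR @hGR @hGR₀ @hGR₁) (@SInstance.χWR @hGR @hGR₀ @hGR₁ (ArchSideTerm.muSharp₂₃ @μ))) (@EtaChi.hη (@SInstance.χVR @hGR @hGR₀ @hGR₁) (@SInstance.χWR @hGR @hGR₀ @hGR₁ (ArchSideTerm.muSharp₂₃ @μ))) (@EtaChi.hηc (@SInstance.χVR @hGR @hGR₀ @hGR₁) (@SInstance.χWR @hGR @hGR₀ @hGR₁ (ArchSideTerm.muSharp₂₃ @μ))) (@SInstance.νR @hGR₁) (@SInstance.hνR @hGR₁) (@SInstance.hνcR @hGR₁) (@SInstance.ν'R @hGR₃) (@SInstance.hν'R @hGR₃) (@SInstance.hν'cR @hGR₃) @hGR₀ @hGR₁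 @hGR₂ @hGR₃ (@SInstance.ART' @SInstance.GOG @SInstance.hG_GOG @hGR (@SInstance.χVR @hGR @hGR₀ @hGR₁) (@SInstance.νR @hGR₁) (@SInstance.ν'R @hGR₃) @hGR₀ @hGR₁ @hGR₂ @hGR₃ (ArchSideTerm.muSharp₂₃ @μ) @SInstance.hpos_GOG (fun V c hc => (ArchSideTerm.hΔ₁_GOG_muSharp₂₃ @hGR @hGR₀ @hGR₁ @hGR₂ @hGR₃ @μ) V c hc) (fun V c hc => (ArchSideTerm.hΔ₂_GOG_muSharp₂₃ @hGR @hGR₀ @hGR₁ @hGR₂ @hGR₃ @μ (ArchSideTerm.hSV_holds @hGR)) V c hc) (fun V c hc => (ArchSideTerm.hΔ₃_GOG_muSharp₂₃ @hGR @hGR₀ @hGR₁ @hGR₂ @hGR₃ @μ (ArchSideTerm.hSV_holds @hGR)) V c hc)) hHD hI h₁ (cmAbelianVarietyRealised_of_eigenbasis hHD hI h₃) (orientBitι L ι₁) hA (ArchSideTerm.muSharp₂₃ @μ) V c (isAnisotropic_of_goodCtx V hc hK.1)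
        (HodgeCM.Universe.AdelicThetaCore.isAnisotropic_gramW_of_goodCtx _ (orientBitι L ι₁) (d12Of (ArchSideTerm.muSharp₂₃ @μ)) (d34Of (ArchSideTerm.muSharp₂₃ @μ)) hc)
        (SInstance.hG_GOG V c ⟨hemb, (HodgeCM.Universe.AdelicThetaCore.thetaModel_goodCtx_iff _ (orientBitι L ι₁) (d12Of (ArchSideTerm.muSharp₂₃ @μ)) (d34Of (ArchSideTerm.muSharp₂₃ @μ)) ι₁ c).mp hc⟩)
        (fun _ _ => (0 : Fin 6))
        (SInstance.hκ_R1_of_GOG_eta @hGR @hGR₀ @hGR₁ (@SInstance.χWR @hGR @hGR₀ @hGR₁ (ArchSideTerm.muSharp₂₃ @μ)) V c ⟨hemb, (HodgeCM.Universe.AdelicThetaCore.thetaModel_goodCtx_iff _ (orientBitι L ι₁) (d12Of (ArchSideTerm.muSharp₂₃ @μ)) (d34Of (ArchSideTerm.muSharp₂₃ @μ)) ι₁ c).mp hc⟩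
          (SInstance.hG_GOG V c ⟨hemb, (HodgeCM.Universe.AdelicThetaCore.thetaModel_goodCtx_iff _ (orientBitι L ι₁) (d12Of (ArchSideTerm.muSharp₂₃ @μ)) (d34Of (ArchSideTerm.muSharp₂₃ @μ)) ι₁ c).mp hc⟩))
        (fun t => ArchSideTerm.hμ₃₄_GOG @hGR (@SInstance.χVR @hGR @hGR₀ @hGR₁) @hGR₀ @hGR₁ @hGR₂ @hGR₃ @μ V c ⟨hemb, (HodgeCM.Universe.AdelicThetaCore.thetaModel_goodCtx_iff _ (orientBitι L ι₁) (d12Of (ArchSideTerm.muSharp₂₃ @μ)) (d34Of (ArchSideTerm.muSharp₂₃ @μ)) ι₁ c).mp hc⟩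
          (SInstance.hG_GOG V c ⟨hemb, (HodgeCM.Universe.AdelicThetaCore.thetaModel_goodCtx_iff _ (orientBitι L ι₁) (d12Of (ArchSideTerm.muSharp₂₃ @μ)) (d34Of (ArchSideTerm.muSharp₂₃ @μ)) ι₁ c).mp hc⟩) _ t)
        (SInstance.hpos_GOG V c ⟨hemb, (HodgeCM.Universe.AdelicThetaCore.thetaModel_goodCtx_iff _ (orientBitι L ι₁) (d12Of (ArchSideTerm.muSharp₂₃ @μ)) (d34Of (ArchSideTerm.muSharp₂₃ @μ)) ι₁ c).mp hc⟩).2.2.1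
        (SInstance.hpos_GOG V c ⟨hemb, (HodgeCM.Universe.AdelicThetaCore.thetaModel_goodCtx_iff _ (orientBitι L ι₁) (d12Of (ArchSideTerm.muSharp₂₃ @μ)) (d34Of (ArchSideTerm.muSharp₂₃ @μ)) ι₁ c).mp hc⟩).2.2.2
        (SInstance.hLF_ROGT'CJ @hGR @hGR₀ @hGR₁ @hGR₂ @hGR₃ @μ V c 2)
        (SInstance.hLF_ROGT'CJ @hGR @hGR₀ @hGR₁ @hGR₂ @hGR₃ @μ V c 3)
        (SInstance.hsupply_two_three_ROGT'CJ hHD hI h₁ (cmAbelianVarietyRealised_of_eigenbasis hHD hI h₃) @hGR @hGR₀ @hGR₁ @hGR₂ @hGR₃ @μ V c ⟨hemb, (HodgeCM.Universe.AdelicThetaCore.thetaModel_goodCtx_iff _ (orientBitι L ι₁) (d12Of (ArchSideTerm.muSharp₂₃ @μ)) (d34Of (ArchSideTerm.muSharp₂₃ @μ)) ι₁ c).mp hc⟩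
          (isAnisotropic_of_goodCtx V hc hK.1)))

end Model

end HodgeCM
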